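import Mathlib
import HarnessLib
import Literature.Analysis.FluidPDE.VorticityCalculus
import Summits.NavierStokesRegularity.NavierStokesRegularity.Theses.PoloidalWindowDoor
import Summits.NavierStokesRegularity.NavierStokesRegularity.Theses.LoopPeriodRatchet
import Summits.NavierStokesRegularity.NavierStokesRegularity.Theorems.PoloidalWindowDoorPoloidalWindowRigidityHotLoopsReduction
import Summits.NavierStokesRegularity.NavierStokesRegularity.Theorems.PoloidalWindowDoorPoloidalWindowRigidityFirstIntegral
import Summits.NavierStokesRegularity.NavierStokesRegularity.Theorems.PoloidalWindowDoorPoloidalWindowRigidityZeroModeHeat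
import Summits.NavierStokesRegularity.NavierStokesRegularity.Theorems.PoloidalWindowDoorPoloidalWindowRigidityZeroModeOseen
import Summits.NavierStokesRegularity.NavierStokesRegularity.Theorems.PoloidalWindowDoorPoloidalWindowRigidityFluxTransport
import Summits.NavierStokesRegularity.NavierStokesRegularity.Theorems.PoloidalWindowDoorPoloidalWindowRigidityHotPlaneConst

/-!
# Crux `PoloidalWindowRigidity` (K2, stmt-NavierStokesRegularity-19708) + item `LrcModEntire` (stmt-20428) — LINE 16 `zero_mode` (v1.2: C1 CLOSED BY NAME)
# (IDEATOR seat ns-idea-8, generation 8; lens «barrier»; bears_on LADDER-NS N0, rung N0-LocalTubeDoorPoloidal, THICK column)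

**WHAT THIS LINE IS.**  A MECHANISM for cell **C1 (hot plane)** of the typed trichotomy HL3′ = C1 ∧ C2a ∧ C2b (`Lines/hot_split.lean` v1.2,
label P15-1: «HL3′ = C1 ∧ C2a ∧ C2b typed, 0/3 closed; hot_loops v4.3 skeleton of record; hot_split = census form»).  The census row §C1 of
`Lines/hot_loops-HL3-census.md` records every single-time attack on the hot plane as dead («the missing ingredient must be ANCIENT — none found»).
This line supplies the ancient ingredient: the **ZERO MODE** (large-scale mean momentum) of a bounded Oseen-mild ancient flow with Type-I decay.

**THE LEVER (three provable stubs + two kernels).**  v1.1 (2026-08-29, prices P16-1/P16-2 of idea-crit-7 g5 PAID): Z is no longer a stub but the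
sorry-free assembly of Z-heat (S/M) and Z-oseen (L); statements of Z, F, NoHotPlane, the cells and the compositions are UNCHANGED (v1 d5911a5f7dbc).
* **Z `ZeroModeLaw` (NEW, PROVABLE; = Z-heat ∧ Z-oseen, booked S/M + L) — the zero-mode law.**  For a class profile (Type-I decay `|v(t,x)| ≤ C/√(−t)`, continuity, the Oseen-mild
  identity `v(t) = e^{(t−s)Δ}v(s) − B_s(v,v)(t)`) the mean of `v₂(t,·)` over the flat boxes `Q_{R,H} = [−R,R]²×[0,H]` tends to `0` as `R, H → ∞`, at EVERY
  time `t < 0`.  Mechanism (pressure-free, from the mild identity alone): pair the identity with `1_Q`.  HEAT PART: `|∫_Q (e^{(t−s)Δ}v(s))₂| =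
  |∫ (G_{t−s} ∗ 1_Q) v₂(s)| ≤ |Q|·‖v(s)‖_∞ ≤ |Q|·C/√(−s)` (the heat semigroup preserves the `L¹`-mass of the test function).  OSEEN PART: the tree kernel
  `K(σ,z)[a,b] = oseenKernel σ z a b` is ODD in `z` (every term of `Literature.Analysis.FluidPDE.oseenKernel` carries an odd number of `z`-factors; the
  weights `heatKernel`, `oseenWeightA/B` are radial) and `|K(σ,z)[a,b]| ≤ C_K(σ+|z|²)^{-2}|a||b|` (`exists_norm_oseenKernel_le`, `d = 3`), so
  `∫_x 1_Q(x)K(σ,x−y)[a,b]dx = ½∫_w (1_Q(y+w) − 1_Q(y−w))K(σ,w)[a,b]dw`, and `∫_y |…| dy ≤ ½C_K|a||b|∫_w (σ+|w|²)^{-2} m(Q △ (Q−2w)) dw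
  ≤ 4πC_K|a||b|·Per(Q)·(2 + log(1 + ρ_Q²/4σ))`, `ρ_Q := |Q|/Per(Q)`; integrating `τ ∈ (s,t)` with `‖v(τ)‖_∞² ≤ C²/(−t)`:
  `|⨍_Q v₂(t)| ≤ C/√(−s) + C′·C²·log((−s)/(−t))·(3 + log(1 + ρ_Q²/4(t−s)))/ρ_Q` for EVERY `s < t` (with the τ-wise Type-I bound
  `‖v(τ)‖_∞² ≤ C²/(−τ)`, whose time integral costs the factor `log((−s)/(−t))`).  ORDER (price P16-2): FIX `s = s(ε,t)` with `C/√(−s) ≤ ε/2` FIRST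
  (Type-I decay in the PAST — the ancient ingredient), THEN `L₀ = L₀(s,t,ε/2)` with the Oseen excess `≤ ε/2`: the mean vanishes.  v1.1 types exactly
  this: Z ⇐ Z-heat (`stub_zeroModeHeat`, S/M) ∧ Z-oseen (`stub_zeroModeOseen`, **L** — Fubini/measurability over `oseenDuhamel` is the cost driver,
  price P16-1) by the sorry-free assembly `zeroModeLaw_of_heat_of_oseen`.  (The same proof gives the law for every component, every box with all sides `→ ∞`, uniformly
  in the centre; only the vertical flat-box instance is typed, because it is the one consumed.)  It is the large-scale AVERAGED form of KNSS's exclusion of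
  the parasitic solutions `v = c(t)`, `p = −c′(t)·x` ([corpus:book:seregin2014 p.113]: «`u = c(t)` is a mild bounded ancient solution iff `c` is
  constant»; [corpus:book:lemarie-rieusset2016 p.40]): mildness freezes the zero mode, Type-I decay makes it `0`.
* **F `stub_fluxTransport` (PROVABLE, S/M) — flux transport.**  If `v₂(t,·) ≡ N` on the plane `P₀ = {y 2 = 0}` then, by incompressibility (divergence
  theorem on `[−R,R]²×[0,z]`: the flux through the top square equals the flux `4R²N` through the bottom square up to the lateral flux `≤ 8R·z·‖v(t)‖_∞`),
  `|∫_{Q_{R,H}} v₂(t) − N·4R²H| ≤ 4‖v(t)‖_∞·R·H²`.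
* **KERNEL (sorry-free here):** `hotPlaneValue_eq_zero : Z → F → (class, div-free, v₂(t,·)|_{P₀} ≡ N ⇒ N = 0)` (choose `ε = |N|/4`, `H = L₀`,
  `R = max L₀ (|M|L₀/|N|)`: then `4|N|R²H ≤ |N|R²H + |N|R²H`), hence **cell C1 of hot_split, VERBATIM, is PROVED modulo Z and F**
  (`cellC1_of_zeroMode_of_flux`, `hotSplit_cellC1`): a pinned profile has `N = v₂(−1,0) ≠ 0` and, in cell C1, `v(−1,·)` constant on `P₀`.
  Neither `ThickWindow` nor `Peakless` nor poloidality is used: NO class profile (poloidal or not) carries a non-zero constant normal velocity on a whole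
  plane at any single time — the «hot plane» is impossible in the entire KNSS class.
* Then HL3′ ⇐ A1 ∧ C2a ∧ C2b (hot_split's split with C1 discharged; A1 `stub_hotPlaneConst` provable M, C2a/C2b OPEN cells, verbatim), and the crux /
  item BY NAME through the landed `…HotLoopsReduction.poloidalWindowRigidity_of_NUGRS_of_growth_of_peakless` / `lrcModEntire_…` from S0 and the wall
  ⟨27893⟩ (verbatim shared stubs).  **v1.2 (2026-08-29 ≈01:30Z): Z-heat, Z-oseen, F and A1 are DISCHARGED BY NAME from the hands' landed Theorems files
  (`…ZeroModeHeat.stub_zeroModeHeat` p681062, `…ZeroModeOseen.stub_zeroModeOseen` p684523 — with `…ZeroModeRadial/…ZeroModeBoxKernel/…ZeroModeBoxes`,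
  K2-p2 g12/g13 —, `…FluxTransport.stub_fluxTransport` p680813, `…HotPlaneConst.stub_hotPlaneConst` p677063; each wiring is `fun C v => <landed> C v`,
  closing by definitional unfolding of `flatBox` / `Pinned`; critic idea-crit-7 g5 BY-NAME ✓ + BOOKING 01:10:11Z), so `zeroMode_Z`, `zeroMode_noHotPlane` and
  hot_split's `stub_cellC1` statement (`zeroMode_cellC1`) are UNCONDITIONAL KERNEL THEOREMS in this file.  A second, independent, sorry-free proof of C1 in
  bump form is `Lines/zero_mode_bump.lean` v2.1 (7846008250bc; critic PASS A−).  Sorries in v1.2 = the FOREIGN cells only: C2a, C2b (hot_split, open) ·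
  S0 (`stub_localTHEmptyHypNUGRS`, 20428's), wall (`stub_wall` = ⟨27893⟩) — none of them a stub of this line.**  (v1.1 had: Z-heat, Z-oseen, F, A1 ·
  C2a, C2b · S0, wall.)
  After Z, F, A1 land: **HL3′ = C2a ∧ C2b** (the hot set of a pinned peakless profile is a RIDGE, never a plane).  No summit is proved by any line.

**WHY THIS LINE / WHY NOVEL (barrier-inversion).**  Every catalogued obstruction of the column kills a CLASS: the finite-jet / Cartan–Kähler barrier kills
LOCAL statements at the hot set; the KNSS-weight barrier kills scalar MAXIMUM PRINCIPLES off symmetry; the divergence-identity barrier (seat g4, census C4)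
kills SIGNED QUADRATIC bulk identities («every weighted double divergence → 0, hence only signed cells die»); `Disproof.lean`
(`not_singular_of_constDir_window`, `noThickObliqueTwistingGerm`, `oblique25_cubic_example`) and census §C1 record that constant-direction windows are
dead, that every admissible finite jet at the hot plane is realisable, and that only MILDNESS + ANCIENT DECAY exclude the z-stratified shears.  The statement just outside all four: a LINEAR density (momentum itself) whose bulk term is not signed
but ABSENT (pure boundary flux + a pressure/Oseen term that is a boundary effect BECAUSE the solution is mild), compared at TWO times (`t` and `s → −∞`),
and confronted with the one configuration — the hot plane — where incompressibility transports single-plane information to a volume.  None of the 15 filed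
lines, the three STRATEGY-CENSUS files, STRATUM-A, POLY-SECTOR, THICK-NF, PINSHEET or the HL3 census uses a conserved large-scale mean; the census C1 row
had the flux transport at ONE time («flux defect ≤ 2πBR|h|, no contradiction») and named the missing ancient ingredient without finding it.

C0 (self-critic): Reduction 4/5 (Z and F are strictly weaker than C1, HL3′, 19708 — Z is a statement about ALL class profiles with no pin, F is vector
calculus; the open residue C2a ∧ C2b is hot_split's, unchanged) · Attack 4/5 (complete proof sketch above with the tree's kernel objects:
`oseenKernel`, `exists_norm_oseenKernel_le`, `exists_lintegral_enorm_oseenKernel_le`, `heatExtension`; first lemma = oddness `oseenKernel σ (−z) a b =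
−oseenKernel σ z a b`) · Lever 4/5 (problem-relative new: zero-mode conservation; nearest prior = KNSS parasitic exclusion for EXACTLY constant fields
[corpus:book:seregin2014 p.113], census §C1 single-time flux defect) · Barriers 4/5 (outside finite-jet, KNSS-weight, divergence-identity classes; HONOURS the landed
`…Theorems.PoloidalWindowRigidity.Negative.poloidalWindowRigidity_false_without_mild` (witness `Literature.Analysis.FluidPDE.parasiticVelocity 1`, the drift
`(−t)^{-1/2}e₀`): that witness IS a hot-plane field and violates Z's conclusion, so Z must — and does — use the mild identity (M), at the step «heat part
≤ |Q|·C/√(−s), s → −∞»; the non-decaying constants (mild, not Type-I) are the other near-miss) · Killable 5/5 (Z is refutable by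
one bounded Oseen-mild ancient Type-I field with a non-vanishing large-box mean; F by one div-free field; both are cheap to test numerically on synthetic
fields — instrument row below).  Predicted: the C1 cell CLOSES when Z, F land (M/L + S/M prover work); the column's residue becomes C2a ∧ C2b ∧ S0 ∧ wall.
CHEAPEST FALSIFIER: (i) of Z — a class profile with `liminf_Q |⨍_Q v₂(t)| > 0`; none can exist by the proof, and the two near-misses are exactly the
non-mild `c(t)e₃` and the non-decaying constants; (ii) of the line's usefulness — none: C1 is a named cell of the skeleton-of-record's residue.
INSTRUMENT ROW (kit not run; deterministic quadrature suffices): `I(σ,ρ) = ∫_{|w|<ρ}|w|(σ+|w|²)^{-2}d³w = 2π(log(1+ρ²/σ) − ρ²/(σ+ρ²))` — the logarithm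
that makes `Per(Q)·log ρ_Q/|Q| → 0` the decisive rate; a refuter checks the oddness of `oseenKernel` symbolically (three terms, each odd in `z`).
BC7: probes of `ZeroModeLaw`, `FluxTransport`, `NoHotPlane` (unbundled defs) against `…PoloidalWindowDoor.PoloidalWindowRigidity`: see `Lines/zero_mode.md`
(cell C1 itself was probed CLEAN as `CellC1` in g7, `Lines/hot_split.md`).
PROCESS (KEY-NS #68/#69): files only — no `skeleton check --crux`, no `propose`.
-/

open scoped InnerProductSpace RealInnerProductSpace Laplacian

-- the summit and its single sub-problem share the name (CONVENTIONS §1)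
set_option linter.dupNamespace false

namespace Summit.NavierStokesRegularity.NavierStokesRegularity.Cruxes.PoloidalWindowRigidity.ZeroMode

open Set Function MeasureTheory
open Literature.Analysis Literature.Analysis.FluidPDE
open Summit.NavierStokesRegularity.NavierStokesRegularity.Theses.LoopPeriodRatchet
open Summit.NavierStokesRegularity.NavierStokesRegularity.Theses.PoloidalWindowDoor
open Summit.NavierStokesRegularity.NavierStokesRegularity.Theorems

/-! ## The three hypothesis packages of HL3′ (VERBATIM `Lines/hot_split.lean` v1.2, so that cell C1 below is hot_split's `stub_cellC1` verbatim) -/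

/-- **Pinned** — VERBATIM hot_split: Type-I decay, continuity, mild identity, div-free, e₃-poloidal, `N := v₂(−1,0) ≠ 0`, the global bound
`√(−t)|v₂| ≤ |N|`, `∇v₂(−1,0) = 0`, the time and Laplace pins. -/
def Pinned (C : ℝ) (v : ℝ → EuclideanSpace ℝ (Fin 3) → EuclideanSpace ℝ (Fin 3)) : Prop :=
  Literature.Analysis.FluidPDE.HasTypeITimeDecay C v ∧
  ContinuousOn (Function.uncurry v) (Set.Iio (0 : ℝ) ×ˢ Set.univ) ∧
  (∀ s t : ℝ, s < t → t < 0 → ∀ x, v t x =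
    Literature.Analysis.UnboundedOperators.heatExtension (v s) (t - s) x -
      Literature.Analysis.FluidPDE.oseenDuhamel 1 s v v t x) ∧
  (∀ t < 0, Literature.Analysis.FluidPDE.VectorCalculus.IsDivFree (v t)) ∧
  (∀ s < 0, ∀ y, ⟪Literature.Analysis.FluidPDE.curl (v s) y, EuclideanSpace.single 2 1⟫_ℝ = 0) ∧
  v (-1) 0 2 ≠ 0 ∧ (∀ t < 0, ∀ x, Real.sqrt (-t) * |v t x 2| ≤ |v (-1) 0 2|) ∧
  (∀ h : EuclideanSpace ℝ (Fin 3), fderiv ℝ (v (-1)) 0 h 2 = 0) ∧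
  (deriv (fun s => v s 0 2) (-1) = v (-1) 0 2 / 2 ∧ v (-1) 0 2 * (Δ (fun y => v (-1) y 2)) 0 ≤ 0)

/-- **ThickWindow** — VERBATIM hot_split. -/
def ThickWindow (v : ℝ → EuclideanSpace ℝ (Fin 3) → EuclideanSpace ℝ (Fin 3)) (W : Set (ℝ × EuclideanSpace ℝ (Fin 3))) : Prop :=
  IsOpen W ∧ W ⊆ Set.Iio (0 : ℝ) ×ˢ Set.univ ∧
  (∀ z ∈ W, (Literature.Analysis.FluidPDE.curl (v z.1) z.2 ≠ 0 ∧
      (fderiv ℝ (v z.1) z.2 (EuclideanSpace.single 0 1) 2 ≠ 0 ∨ fderiv ℝ (v z.1) z.2 (EuclideanSpace.single 1 1) 2 ≠ 0) ∧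
      (fderiv ℝ (v z.1) z.2 (EuclideanSpace.single 2 1) 0 ≠ 0 ∨ fderiv ℝ (v z.1) z.2 (EuclideanSpace.single 2 1) 1 ≠ 0)) ∧
    (fderiv ℝ (fun x => fderiv ℝ (v z.1) x (EuclideanSpace.single 2 1) 2) z.2 (EuclideanSpace.single 0 1) *
          fderiv ℝ (v z.1) z.2 (EuclideanSpace.single 1 1) 2 -
        fderiv ℝ (fun x => fderiv ℝ (v z.1) x (EuclideanSpace.single 2 1) 2) z.2 (EuclideanSpace.single 1 1) *
          fderiv ℝ (v z.1) z.2 (EuclideanSpace.single 0 1) 2 ≠ 0)) ∧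
  (∀ m : ℝ → ℝ → ℝ, ∀ W₁ : Set (ℝ × EuclideanSpace ℝ (Fin 3)), W₁ ⊆ W → IsOpen W₁ → W₁.Nonempty →
      ∃ z ∈ W₁, ∃ b : Fin 3, b ≠ 2 ∧
        fderiv ℝ (v z.1) z.2 (EuclideanSpace.single 2 1) b ≠
          m z.1 (z.2 2) * fderiv ℝ (v z.1) z.2 (EuclideanSpace.single b 1) 2) ∧
  (∀ r : ℝ, 0 < r → (Metric.ball ((-1 : ℝ), (0 : EuclideanSpace ℝ (Fin 3))) r ∩ W).Nonempty)

/-- **Peakless** — VERBATIM hot_split: no island bracket of `σ·v₂(s,·)` on any horizontal plane at any time `s < 0`. -/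
def Peakless (v : ℝ → EuclideanSpace ℝ (Fin 3) → EuclideanSpace ℝ (Fin 3)) : Prop :=
  ∀ (s z₀ σ M : ℝ) (K O : Set (EuclideanSpace ℝ (Fin 3))), s < 0 →
    ((σ = 1 ∨ σ = -1) ∧ IsCompact K ∧ K.Nonempty ∧ (∀ y ∈ K, y 2 = z₀ ∧ σ * v s y 2 = M) ∧
      IsOpen O ∧ K ⊆ O ∧ (∀ y ∈ O, y 2 = z₀ → σ * v s y 2 ≤ M) ∧
      (∀ y ∈ O, y 2 = z₀ → σ * v s y 2 = M → y ∈ K)) → False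

/-! ## The flat boxes and the two new statements -/

/-- The flat box `Q_{R,H} = [−R,R]² × [0,H] ⊂ ℝ³` (base in the hot-spot plane `P₀ = {x 2 = 0}`, height `H`); `|Q_{R,H}| = 4R²H`. -/
def flatBox (R H : ℝ) : Set (EuclideanSpace ℝ (Fin 3)) :=
  {x | |x 0| ≤ R ∧ |x 1| ≤ R ∧ 0 ≤ x 2 ∧ x 2 ≤ H}

/-- **Z — the zero-mode law** (flat-box, vertical-component instance).  For a class profile the mean of `v₂(t,·)` over `Q_{R,H}` is `≤ ε` in modulus
once `R, H ≥ L₀(ε,t)`.  Proof route in the file header (heat part: `L¹`-mass of `G ∗ 1_Q`; Oseen part: oddness + `(σ+|z|²)^{-2}` bound of `oseenKernel`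
⇒ `Per(Q)·log ρ_Q` boundary cost; then `s → −∞` by Type-I decay).  Tree: `Literature.Analysis.FluidPDE.oseenKernel`, `exists_norm_oseenKernel_le`,
`exists_lintegral_enorm_oseenKernel_le`, `oseenDuhamel_apply`, `UnboundedOperators.heatExtension`.  [KNSS 2009 §4; corpus:book:seregin2014 p.113] -/
def ZeroModeLaw : Prop :=
  ∀ (C : ℝ) (v : ℝ → EuclideanSpace ℝ (Fin 3) → EuclideanSpace ℝ (Fin 3)),
    Literature.Analysis.FluidPDE.HasTypeITimeDecay C v →
    ContinuousOn (Function.uncurry v) (Set.Iio (0 : ℝ) ×ˢ Set.univ) →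
    (∀ s t : ℝ, s < t → t < 0 → ∀ x, v t x =
      Literature.Analysis.UnboundedOperators.heatExtension (v s) (t - s) x -
        Literature.Analysis.FluidPDE.oseenDuhamel 1 s v v t x) →
    ∀ t : ℝ, t < 0 → ∀ ε : ℝ, 0 < ε → ∃ L₀ : ℝ, 0 < L₀ ∧ ∀ R H : ℝ, L₀ ≤ R → L₀ ≤ H →
      |∫ x in flatBox R H, v t x 2| ≤ ε * (4 * R ^ 2 * H)

/-- **Z-heat** (PROVABLE, S/M; price P16-1): the free (caloric) evolution from time `s` has box integrals bounded by the Type-I datum times the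
volume — `|∫_{Q_{R,H}} (e^{(t−s)Δ}v(s))₂| ≤ (C/√(−s))·4R²H`.  Route: pointwise `‖heatExtension (v s) (t−s) x‖ ≤ C/√(−s)` by the tree's
`Literature.Analysis.UnboundedOperators.norm_heatExtension_le` (heat kernel has mass 1; only the pointwise bound `‖v s y‖ ≤ C/√(−s)` of
`HasTypeITimeDecay` is needed), then `MeasureTheory.norm_setIntegral_le_of_norm_le_const` with `volume (flatBox R H) = 4R²H`
(`EuclideanSpace.volume_preserving_measurableEquiv` to the product box `[−R,R]²×[0,H]`). -/
def ZeroModeHeat : Prop :=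
  ∀ (C : ℝ) (v : ℝ → EuclideanSpace ℝ (Fin 3) → EuclideanSpace ℝ (Fin 3)),
    Literature.Analysis.FluidPDE.HasTypeITimeDecay C v →
    ∀ s t : ℝ, s < t → t < 0 → ∀ R H : ℝ, 0 < R → 0 < H →
      |∫ x in flatBox R H, Literature.Analysis.UnboundedOperators.heatExtension (v s) (t - s) x 2| ≤
        C / Real.sqrt (-s) * (4 * R ^ 2 * H)

/-- **stub Z-heat** (PROVABLE, S/M). -/
theorem stub_zeroModeHeat : ZeroModeHeat :=
  fun C v => PoloidalWindowDoorPoloidalWindowRigidityZeroModeHeat.stub_zeroModeHeat C v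

/-- **Z-oseen** (PROVABLE, L; price P16-1): for FIXED `s < t < 0` the box integral of `v₂(t)` exceeds that of the free evolution from time `s` by at
most `ε·|Q_{R,H}|` once `R, H ≥ L₀(s,t,ε)`.  By the mild identity the excess IS the box integral of the Oseen–Duhamel term
`(oseenDuhamel 1 s v v t ·)₂` (stated in this subtraction-free form so that the assembly below is pure arithmetic; the integrability bookkeeping —
`v t` continuous on the compact box, the heat part bounded — lives inside this stub).  Route (file header, OSEEN PART): (i) tree lemma to state first,
`oseenKernel_neg : oseenKernel τ (−z) a b = −oseenKernel τ z a b` (each of the three terms of `Literature.Analysis.FluidPDE.oseenKernel`,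
KochTataru.lean:150, carries an odd number of `z`-factors against the radial weights `heatKernel`, `oseenWeightA/B`); (ii) Fubini through the iterated
Bochner integral `oseenDuhamel_apply` (the cost driver — cf. the precession hands' experience with the same integrand); (iii) the symmetric-difference
estimate `m(Q △ (Q − 2w)) ≤ min(2|Q|, 2|w|·Per Q)` for flat boxes and `|K(τ,w)[a,b]| ≤ C_K(τ+|w|²)^{-2}|a||b|` (`exists_norm_oseenKernel_le`, `d = 3`),
giving `∫_y|∫_Q K(τ,·−y)[a,b]| ≤ 4πC_K|a||b|·Per(Q)·(2 + log(1+ρ_Q²/4τ))`, `ρ_Q = |Q|/Per Q = RH/(R+2H)·2 ≥ min(R,H)/2`… ; (iv) the time integral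
`∫_s^t ‖v(τ)‖_∞² dτ ≤ C²·log((−s)/(−t))` (Type-I, τ-wise) — the `log(−s)` factor is why `L₀` depends on `s` (ORDER: the assembly fixes `s(ε,t)` FIRST,
then takes `L₀(s,t,ε/2)` from this stub; price P16-2).  Net: excess `≤ C′·C²·log((−s)/(−t))·Per(Q)·(3 + log(1+ρ_Q²/4(t−s)))`, and
`Per(Q)·log ρ_Q/|Q| → 0` as `min(R,H) → ∞`. -/
def ZeroModeOseen : Prop :=
  ∀ (C : ℝ) (v : ℝ → EuclideanSpace ℝ (Fin 3) → EuclideanSpace ℝ (Fin 3)),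
    Literature.Analysis.FluidPDE.HasTypeITimeDecay C v →
    ContinuousOn (Function.uncurry v) (Set.Iio (0 : ℝ) ×ˢ Set.univ) →
    (∀ s t : ℝ, s < t → t < 0 → ∀ x, v t x =
      Literature.Analysis.UnboundedOperators.heatExtension (v s) (t - s) x -
        Literature.Analysis.FluidPDE.oseenDuhamel 1 s v v t x) →
    ∀ s t : ℝ, s < t → t < 0 → ∀ ε : ℝ, 0 < ε → ∃ L₀ : ℝ, 0 < L₀ ∧ ∀ R H : ℝ, L₀ ≤ R → L₀ ≤ H →
      |∫ x in flatBox R H, v t x 2| ≤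
        |∫ x in flatBox R H, Literature.Analysis.UnboundedOperators.heatExtension (v s) (t - s) x 2| + ε * (4 * R ^ 2 * H)

/-- **stub Z-oseen** (PROVABLE, L). -/
theorem stub_zeroModeOseen : ZeroModeOseen :=
  fun C v => PoloidalWindowDoorPoloidalWindowRigidityZeroModeOseen.stub_zeroModeOseen C v

/-- **ASSEMBLY `Z ⇐ Z-heat ∧ Z-oseen`** (sorry-free; the «10-line assembly» of price P16-1, in the ORDER of price P16-2): given `t < 0` and `ε > 0`
choose the past time `s := t − 1 − (2C/ε)²` (so `C/√(−s) ≤ ε/2` — Type-I decay in the PAST, the ancient ingredient), then `L₀ := L₀(s,t,ε/2)` from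
Z-oseen; for `R, H ≥ L₀`: `|∫_Q v₂(t)| ≤ |∫_Q heat₂| + (ε/2)|Q| ≤ (C/√(−s))|Q| + (ε/2)|Q| ≤ ε|Q|`. -/
theorem zeroModeLaw_of_heat_of_oseen (hH : ZeroModeHeat) (hO : ZeroModeOseen) : ZeroModeLaw := by
  intro C v hT hc hm t ht ε hε
  set s : ℝ := t - 1 - (2 * C / ε) ^ 2 with hs_def
  have hsq0 : 0 ≤ (2 * C / ε) ^ 2 := sq_nonneg _
  have hst : s < t := by rw [hs_def]; linarith
  have hs0 : 0 < -s := by rw [hs_def]; linarith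
  have hspos : 0 < Real.sqrt (-s) := Real.sqrt_pos.2 hs0
  -- the past time `s` makes the heat part `≤ ε/2`
  have hCs : C / Real.sqrt (-s) ≤ ε / 2 := by
    have h1 : Real.sqrt ((2 * C / ε) ^ 2) ≤ Real.sqrt (-s) :=
      Real.sqrt_le_sqrt (by rw [hs_def]; linarith)
    rw [Real.sqrt_sq_eq_abs] at h1
    have h2 : |2 * C / ε| = 2 * |C| / ε := by
      rw [abs_div, abs_mul, abs_of_pos hε, abs_of_pos (by norm_num : (0:ℝ) < 2)]
    rw [h2] at h1
    have h3 : 2 * |C| ≤ ε * Real.sqrt (-s) := by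
      have := (div_le_iff₀ hε).1 h1
      linarith [this]
    have h4 : C ≤ |C| := le_abs_self C
    rw [div_le_iff₀ hspos]
    nlinarith [h3, h4, hspos.le]
  obtain ⟨L₀, hL₀, hL⟩ := hO C v hT hc hm s t hst ht (ε / 2) (by positivity)
  refine ⟨L₀, hL₀, fun R H hR hH' => ?_⟩
  have hRpos : 0 < R := hL₀.trans_le hR
  have hHpos : 0 < H := hL₀.trans_le hH'
  have hvol : 0 < 4 * R ^ 2 * H := by positivity
  have h1 := hH C v hT s t hst ht R H hRpos hHpos
  have h2 := hL R H hR hH'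
  have h3 : C / Real.sqrt (-s) * (4 * R ^ 2 * H) ≤ ε / 2 * (4 * R ^ 2 * H) :=
    mul_le_mul_of_nonneg_right hCs hvol.le
  calc |∫ x in flatBox R H, v t x 2|
      ≤ |∫ x in flatBox R H, Literature.Analysis.UnboundedOperators.heatExtension (v s) (t - s) x 2| +
          ε / 2 * (4 * R ^ 2 * H) := h2
    _ ≤ ε / 2 * (4 * R ^ 2 * H) + ε / 2 * (4 * R ^ 2 * H) := by linarith
    _ = ε * (4 * R ^ 2 * H) := by ring

/-- **Z on this line** (⇐ Z-heat ∧ Z-oseen; v1.2: sorry-free, both discharged by name from Theorems). -/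
theorem zeroMode_Z : ZeroModeLaw :=
  zeroModeLaw_of_heat_of_oseen stub_zeroModeHeat stub_zeroModeOseen

/-- **F — flux transport** (PROVABLE, S/M).  If the vertical velocity is constant (`= v₂(t,0)`) on the whole plane `P₀` at a time `t < 0`, then
incompressibility transports that value to the flat boxes up to the lateral flux: `|∫_{Q_{R,H}} v₂(t) − v₂(t,0)·4R²H| ≤ M·R·H²` (one may take
`M = 4·C/√(−t)`).  Route: `f(z) := ∫_{[−R,R]²×{z}} v₂(t)`, `f′(z) = ∫ ∂_z v₂ = −∫ (∂₀v₀ + ∂₁v₁) = −∮ v_h·n` (div-free = trace of `fderiv`, then the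
planar divergence theorem `MeasureTheory.integral2_divergence_prod_of_hasFDerivWithinAt_off_countable`), `|f′| ≤ 8R‖v(t)‖_∞`, integrate `z ∈ [0,H]`;
slices are real-analytic, hence `C¹`: tree `…Theorems.PoloidalWindowDoorPoloidalWindowRigidityTypeIAnalytic.typeI_mild_slice_analytic`;
boundedness `bdd_of_hasTypeITimeDecay`. -/
def FluxTransport : Prop :=
  ∀ (C : ℝ) (v : ℝ → EuclideanSpace ℝ (Fin 3) → EuclideanSpace ℝ (Fin 3)),
    Literature.Analysis.FluidPDE.HasTypeITimeDecay C v →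
    ContinuousOn (Function.uncurry v) (Set.Iio (0 : ℝ) ×ˢ Set.univ) →
    (∀ s t : ℝ, s < t → t < 0 → ∀ x, v t x =
      Literature.Analysis.UnboundedOperators.heatExtension (v s) (t - s) x -
        Literature.Analysis.FluidPDE.oseenDuhamel 1 s v v t x) →
    (∀ t < 0, Literature.Analysis.FluidPDE.VectorCalculus.IsDivFree (v t)) →
    ∀ t : ℝ, t < 0 → (∀ y : EuclideanSpace ℝ (Fin 3), y 2 = 0 → v t y 2 = v t 0 2) →
      ∃ M : ℝ, ∀ R H : ℝ, 0 < R → 0 < H →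
        |(∫ x in flatBox R H, v t x 2) - v t 0 2 * (4 * R ^ 2 * H)| ≤ M * R * H ^ 2

/-- **stub F** (PROVABLE, S/M). -/
theorem stub_fluxTransport : FluxTransport :=
  fun C v => PoloidalWindowDoorPoloidalWindowRigidityFluxTransport.stub_fluxTransport C v

/-! ## Kernel: no hot plane -/

/-- **No hot plane** (the statement, unbundled for the probes): in the class, a plane on which the normal velocity is constant at one time carries the
value `0`. -/
def NoHotPlane : Prop :=
  ∀ (C : ℝ) (v : ℝ → EuclideanSpace ℝ (Fin 3) → EuclideanSpace ℝ (Fin 3)),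
    Literature.Analysis.FluidPDE.HasTypeITimeDecay C v →
    ContinuousOn (Function.uncurry v) (Set.Iio (0 : ℝ) ×ˢ Set.univ) →
    (∀ s t : ℝ, s < t → t < 0 → ∀ x, v t x =
      Literature.Analysis.UnboundedOperators.heatExtension (v s) (t - s) x -
        Literature.Analysis.FluidPDE.oseenDuhamel 1 s v v t x) →
    (∀ t < 0, Literature.Analysis.FluidPDE.VectorCalculus.IsDivFree (v t)) →
    ∀ t : ℝ, t < 0 → (∀ y : EuclideanSpace ℝ (Fin 3), y 2 = 0 → v t y 2 = v t 0 2) → v t 0 2 = 0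

/-- **KERNEL `noHotPlane_of_zeroMode_of_flux : Z → F → NoHotPlane`** (sorry-free; real arithmetic).  With `N := v₂(t,0) ≠ 0`, `ε := |N|/4`,
`H := L₀`, `R := max L₀ (|M|·L₀/|N|)`: Z gives `|I| ≤ |N|R²H`, F gives `|I − 4N R²H| ≤ M R H² ≤ |N|R²H`, so `4|N|R²H ≤ 2|N|R²H`, absurd. -/
theorem noHotPlane_of_zeroMode_of_flux (hZ : ZeroModeLaw) (hF : FluxTransport) : NoHotPlane := by
  intro C v hrate hcont hmild hdiv t ht hplane
  by_contra hN
  have hNpos : 0 < |v t 0 2| := abs_pos.mpr hN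
  obtain ⟨L₀, hL₀, hZ'⟩ := hZ C v hrate hcont hmild t ht (|v t 0 2| / 4) (by positivity)
  obtain ⟨M, hM⟩ := hF C v hrate hcont hmild hdiv t ht hplane
  -- the box: height `H = L₀`, half-width `R = max L₀ (|M| L₀ / |N|)`
  set N : ℝ := v t 0 2 with hNdef
  set R : ℝ := max L₀ (|M| * L₀ / |N|) with hRdef
  have hR₁ : L₀ ≤ R := le_max_left _ _
  have hR₂ : |M| * L₀ / |N| ≤ R := le_max_right _ _
  have hRpos : 0 < R := lt_of_lt_of_le hL₀ hR₁
  have h₁ := hZ' R L₀ hR₁ le_rfl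
  have h₂ := hM R L₀ hRpos hL₀
  set I : ℝ := ∫ x in flatBox R L₀, v t x 2 with hIdef
  have hML : |M| * L₀ ≤ |N| * R := by
    have h := (div_le_iff₀ hNpos).mp hR₂
    linarith [h]
  have h₃ : M * R * L₀ ^ 2 ≤ |N| * R ^ 2 * L₀ := by
    calc M * R * L₀ ^ 2 ≤ |M| * R * L₀ ^ 2 := by gcongr; exact le_abs_self M
      _ = (|M| * L₀) * (R * L₀) := by ring
      _ ≤ (|N| * R) * (R * L₀) := by gcongr
      _ = |N| * R ^ 2 * L₀ := by ring
  have h₄ : |N * (4 * R ^ 2 * L₀)| ≤ |I| + |I - N * (4 * R ^ 2 * L₀)| := by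
    calc |N * (4 * R ^ 2 * L₀)| = |I - (I - N * (4 * R ^ 2 * L₀))| := by congr 1; ring
      _ ≤ |I| + |I - N * (4 * R ^ 2 * L₀)| := abs_sub _ _
  have h₅ : |N * (4 * R ^ 2 * L₀)| = |N| * (4 * R ^ 2 * L₀) := by
    rw [abs_mul, abs_of_pos (by positivity : (0 : ℝ) < 4 * R ^ 2 * L₀)]
  have hK : 0 < |N| * (R ^ 2 * L₀) := by positivity
  nlinarith [h₁, h₂, h₃, h₄, h₅, hK]

/-- **No hot plane on this line** (⇐ Z ∧ F). -/
theorem zeroMode_noHotPlane : NoHotPlane :=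
  noHotPlane_of_zeroMode_of_flux zeroMode_Z stub_fluxTransport

/-! ## Cell C1 of hot_split, VERBATIM, proved modulo Z and F -/

/-- **Cell C1 (hot plane ⇒ ∅) — the statement of hot_split's `stub_cellC1`, VERBATIM — from `NoHotPlane`**: a pinned profile has
`N = v₂(−1,0) ≠ 0`, and in cell C1 `v(−1,·)` is constant on `P₀`; `ThickWindow`, `Peakless`, poloidality are not used. -/
theorem cellC1_of_noHotPlane (hNHP : NoHotPlane) :
    ∀ (C : ℝ) (v : ℝ → EuclideanSpace ℝ (Fin 3) → EuclideanSpace ℝ (Fin 3)) (W : Set (ℝ × EuclideanSpace ℝ (Fin 3))),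
      Pinned C v → ThickWindow v W → Peakless v →
      (∀ y : EuclideanSpace ℝ (Fin 3), y 2 = 0 →
        v (-1) y = v (-1) 0 ∧ fderiv ℝ (fun x => v (-1) x 2) y (EuclideanSpace.single 2 1) = 0) →
      False := by
  intro C v W hP _hT _hK hplane
  obtain ⟨hrate, hcont, hmild, hdiv, -, hV, -⟩ := hP
  have hconst : ∀ y : EuclideanSpace ℝ (Fin 3), y 2 = 0 → v (-1) y 2 = v (-1) 0 2 := fun y hy => by
    rw [(hplane y hy).1]
  exact hV (hNHP C v hrate hcont hmild hdiv (-1) (by norm_num) hconst)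

/-- **Cell C1 from Z and F** (kernel). -/
theorem cellC1_of_zeroMode_of_flux (hZ : ZeroModeLaw) (hF : FluxTransport) :
    ∀ (C : ℝ) (v : ℝ → EuclideanSpace ℝ (Fin 3) → EuclideanSpace ℝ (Fin 3)) (W : Set (ℝ × EuclideanSpace ℝ (Fin 3))),
      Pinned C v → ThickWindow v W → Peakless v →
      (∀ y : EuclideanSpace ℝ (Fin 3), y 2 = 0 →
        v (-1) y = v (-1) 0 ∧ fderiv ℝ (fun x => v (-1) x 2) y (EuclideanSpace.single 2 1) = 0) →
      False :=
  cellC1_of_noHotPlane (noHotPlane_of_zeroMode_of_flux hZ hF)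

/-- **hot_split's cell C1 on this line** (⇐ Z ∧ F; v1.2: an unconditional kernel theorem — Z-heat, Z-oseen, F landed). -/
theorem hotSplit_cellC1 :
    ∀ (C : ℝ) (v : ℝ → EuclideanSpace ℝ (Fin 3) → EuclideanSpace ℝ (Fin 3)) (W : Set (ℝ × EuclideanSpace ℝ (Fin 3))),
      Pinned C v → ThickWindow v W → Peakless v →
      (∀ y : EuclideanSpace ℝ (Fin 3), y 2 = 0 →
        v (-1) y = v (-1) 0 ∧ fderiv ℝ (fun x => v (-1) x 2) y (EuclideanSpace.single 2 1) = 0) →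
      False :=
  cellC1_of_noHotPlane zeroMode_noHotPlane

/-! ## The remaining stubs of the split (VERBATIM hot_split v1.2): A1 (provable), C2a, C2b (open cells) -/

/-- **A1 `stub_hotPlaneConst` (PROVABLE, M) — VERBATIM hot_split.**  Every point of `P₀` hot ⇒ `v(−1,·)` constant on `P₀` and `∂_z v₂ = 0` there
(planar harmonic Liouville, tree `Literature.Analysis.FluidPDE.isConst_of_harmonic_bounded`). -/
theorem stub_hotPlaneConst :
    ∀ (C : ℝ) (v : ℝ → EuclideanSpace ℝ (Fin 3) → EuclideanSpace ℝ (Fin 3)), Pinned C v →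
      (∀ y : EuclideanSpace ℝ (Fin 3), y 2 = 0 → v (-1) y 2 = v (-1) 0 2) →
      ∀ y : EuclideanSpace ℝ (Fin 3), y 2 = 0 →
        v (-1) y = v (-1) 0 ∧ fderiv ℝ (fun x => v (-1) x 2) y (EuclideanSpace.single 2 1) = 0 :=
  fun C v hP h y hy => PoloidalWindowDoorPoloidalWindowRigidityHotPlaneConst.stub_hotPlaneConst C v hP h y hy

/-- **Cell C2a `stub_cellC2a` — HOT NON-STATIONARY VORTEX LINE ⇒ ∅ (OPEN) — VERBATIM hot_split v1.2.** -/
theorem stub_cellC2a :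
    ∀ (C : ℝ) (v : ℝ → EuclideanSpace ℝ (Fin 3) → EuclideanSpace ℝ (Fin 3)) (W : Set (ℝ × EuclideanSpace ℝ (Fin 3))),
      Pinned C v → ThickWindow v W → Peakless v →
      (∃ y : EuclideanSpace ℝ (Fin 3), y 2 = 0 ∧ v (-1) y 2 ≠ v (-1) 0 2) →
      (∀ s < 0, ∀ y, ⟪fderiv ℝ (v s) y (Literature.Analysis.FluidPDE.curl (v s) y), EuclideanSpace.single 2 1⟫_ℝ = 0) →
      (∃ y : EuclideanSpace ℝ (Fin 3), y 2 = 0 ∧ v (-1) y 2 = v (-1) 0 2 ∧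
        Literature.Analysis.FluidPDE.curl (v (-1)) y ≠ 0) →
      False := by
  sorry

/-- **Cell C2b `stub_cellC2b` — NULL RIDGE ⇒ ∅ (OPEN) — VERBATIM hot_split v1.2.** -/
theorem stub_cellC2b :
    ∀ (C : ℝ) (v : ℝ → EuclideanSpace ℝ (Fin 3) → EuclideanSpace ℝ (Fin 3)) (W : Set (ℝ × EuclideanSpace ℝ (Fin 3))),
      Pinned C v → ThickWindow v W → Peakless v →
      (∃ y : EuclideanSpace ℝ (Fin 3), y 2 = 0 ∧ v (-1) y 2 ≠ v (-1) 0 2) →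
      (∀ s < 0, ∀ y, ⟪fderiv ℝ (v s) y (Literature.Analysis.FluidPDE.curl (v s) y), EuclideanSpace.single 2 1⟫_ℝ = 0) →
      (∀ y : EuclideanSpace ℝ (Fin 3), y 2 = 0 → v (-1) y 2 = v (-1) 0 2 →
        Literature.Analysis.FluidPDE.curl (v (-1)) y = 0) →
      False := by
  sorry

/-! ## Kernel: HL3′ ⇐ A1 ∧ C2a ∧ C2b (hot_split's split with C1 DISCHARGED by the zero mode) -/

/-- **HL3′ from A1, C2a, C2b** — hot_split's `peaklessEmpty_of_split` with the C1 slot filled by `hotSplit_cellC1`.  Kernel-checked. -/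
theorem peaklessEmpty_of_ridgeCells
    (hA1 : ∀ (C : ℝ) (v : ℝ → EuclideanSpace ℝ (Fin 3) → EuclideanSpace ℝ (Fin 3)), Pinned C v →
      (∀ y : EuclideanSpace ℝ (Fin 3), y 2 = 0 → v (-1) y 2 = v (-1) 0 2) →
      ∀ y : EuclideanSpace ℝ (Fin 3), y 2 = 0 →
        v (-1) y = v (-1) 0 ∧ fderiv ℝ (fun x => v (-1) x 2) y (EuclideanSpace.single 2 1) = 0)
    (hC2a : ∀ (C : ℝ) (v : ℝ → EuclideanSpace ℝ (Fin 3) → EuclideanSpace ℝ (Fin 3)) (W : Set (ℝ × EuclideanSpace ℝ (Fin 3))),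
      Pinned C v → ThickWindow v W → Peakless v →
      (∃ y : EuclideanSpace ℝ (Fin 3), y 2 = 0 ∧ v (-1) y 2 ≠ v (-1) 0 2) →
      (∀ s < 0, ∀ y, ⟪fderiv ℝ (v s) y (Literature.Analysis.FluidPDE.curl (v s) y), EuclideanSpace.single 2 1⟫_ℝ = 0) →
      (∃ y : EuclideanSpace ℝ (Fin 3), y 2 = 0 ∧ v (-1) y 2 = v (-1) 0 2 ∧
        Literature.Analysis.FluidPDE.curl (v (-1)) y ≠ 0) → False)
    (hC2b : ∀ (C : ℝ) (v : ℝ → EuclideanSpace ℝ (Fin 3) → EuclideanSpace ℝ (Fin 3)) (W : Set (ℝ × EuclideanSpace ℝ (Fin 3))),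
      Pinned C v → ThickWindow v W → Peakless v →
      (∃ y : EuclideanSpace ℝ (Fin 3), y 2 = 0 ∧ v (-1) y 2 ≠ v (-1) 0 2) →
      (∀ s < 0, ∀ y, ⟪fderiv ℝ (v s) y (Literature.Analysis.FluidPDE.curl (v s) y), EuclideanSpace.single 2 1⟫_ℝ = 0) →
      (∀ y : EuclideanSpace ℝ (Fin 3), y 2 = 0 → v (-1) y 2 = v (-1) 0 2 →
        Literature.Analysis.FluidPDE.curl (v (-1)) y = 0) → False) :
    ∀ (C : ℝ) (v : ℝ → EuclideanSpace ℝ (Fin 3) → EuclideanSpace ℝ (Fin 3)),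
      Literature.Analysis.FluidPDE.HasTypeITimeDecay C v →
      ContinuousOn (Function.uncurry v) (Set.Iio (0 : ℝ) ×ˢ Set.univ) →
      (∀ s t : ℝ, s < t → t < 0 → ∀ x, v t x =
        Literature.Analysis.UnboundedOperators.heatExtension (v s) (t - s) x -
          Literature.Analysis.FluidPDE.oseenDuhamel 1 s v v t x) →
      (∀ t < 0, Literature.Analysis.FluidPDE.VectorCalculus.IsDivFree (v t)) →
      (∀ s < 0, ∀ y, ⟪Literature.Analysis.FluidPDE.curl (v s) y, EuclideanSpace.single 2 1⟫_ℝ = 0) →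
      v (-1) 0 2 ≠ 0 → (∀ t < 0, ∀ x, Real.sqrt (-t) * |v t x 2| ≤ |v (-1) 0 2|) →
      (∀ h : EuclideanSpace ℝ (Fin 3), fderiv ℝ (v (-1)) 0 h 2 = 0) →
      (deriv (fun s => v s 0 2) (-1) = v (-1) 0 2 / 2 ∧ v (-1) 0 2 * (Δ (fun y => v (-1) y 2)) 0 ≤ 0) →
      ∀ W : Set (ℝ × EuclideanSpace ℝ (Fin 3)), IsOpen W → W ⊆ Set.Iio (0 : ℝ) ×ˢ Set.univ →
        (∀ z ∈ W, (Literature.Analysis.FluidPDE.curl (v z.1) z.2 ≠ 0 ∧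
            (fderiv ℝ (v z.1) z.2 (EuclideanSpace.single 0 1) 2 ≠ 0 ∨ fderiv ℝ (v z.1) z.2 (EuclideanSpace.single 1 1) 2 ≠ 0) ∧
            (fderiv ℝ (v z.1) z.2 (EuclideanSpace.single 2 1) 0 ≠ 0 ∨ fderiv ℝ (v z.1) z.2 (EuclideanSpace.single 2 1) 1 ≠ 0)) ∧
          (fderiv ℝ (fun x => fderiv ℝ (v z.1) x (EuclideanSpace.single 2 1) 2) z.2 (EuclideanSpace.single 0 1) *
                fderiv ℝ (v z.1) z.2 (EuclideanSpace.single 1 1) 2 -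
              fderiv ℝ (fun x => fderiv ℝ (v z.1) x (EuclideanSpace.single 2 1) 2) z.2 (EuclideanSpace.single 1 1) *
                fderiv ℝ (v z.1) z.2 (EuclideanSpace.single 0 1) 2 ≠ 0)) →
        (∀ m : ℝ → ℝ → ℝ, ∀ W₁ : Set (ℝ × EuclideanSpace ℝ (Fin 3)), W₁ ⊆ W → IsOpen W₁ → W₁.Nonempty →
            ∃ z ∈ W₁, ∃ b : Fin 3, b ≠ 2 ∧
              fderiv ℝ (v z.1) z.2 (EuclideanSpace.single 2 1) b ≠
                m z.1 (z.2 2) * fderiv ℝ (v z.1) z.2 (EuclideanSpace.single b 1) 2) →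
        (∀ r : ℝ, 0 < r → (Metric.ball ((-1 : ℝ), (0 : EuclideanSpace ℝ (Fin 3))) r ∩ W).Nonempty) →
        (∀ (s z₀ σ M : ℝ) (K O : Set (EuclideanSpace ℝ (Fin 3))), s < 0 →
          ((σ = 1 ∨ σ = -1) ∧ IsCompact K ∧ K.Nonempty ∧ (∀ y ∈ K, y 2 = z₀ ∧ σ * v s y 2 = M) ∧
            IsOpen O ∧ K ⊆ O ∧ (∀ y ∈ O, y 2 = z₀ → σ * v s y 2 ≤ M) ∧
            (∀ y ∈ O, y 2 = z₀ → σ * v s y 2 = M → y ∈ K)) → False) →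
        False := by
  intro C v hrate hcont hmild hdiv hpol hV hsup hgrad hpins W hWo hWs hW hnTH hacc hpeak
  have hP : Pinned C v := ⟨hrate, hcont, hmild, hdiv, hpol, hV, hsup, hgrad, hpins⟩
  have hT : ThickWindow v W := ⟨hWo, hWs, hW, hnTH, hacc⟩
  have hK : Peakless v := hpeak
  have hF : ∀ s < 0, ∀ y, ⟪fderiv ℝ (v s) y (Literature.Analysis.FluidPDE.curl (v s) y), EuclideanSpace.single 2 1⟫_ℝ = 0 :=
    Summit.NavierStokesRegularity.NavierStokesRegularity.Theorems.PoloidalWindowDoorPoloidalWindowRigidityFirstIntegral.stub_firstIntegral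
      C v hrate hcont hmild hdiv (EuclideanSpace.single 2 1) hpol
  by_cases hplane : ∀ y : EuclideanSpace ℝ (Fin 3), y 2 = 0 → v (-1) y 2 = v (-1) 0 2
  · exact hotSplit_cellC1 C v W hP hT hK (hA1 C v hP hplane)
  · push Not at hplane
    obtain ⟨y, hy0, hyne⟩ := hplane
    by_cases hnull : ∀ y : EuclideanSpace ℝ (Fin 3), y 2 = 0 → v (-1) y 2 = v (-1) 0 2 →
        Literature.Analysis.FluidPDE.curl (v (-1)) y = 0
    · exact hC2b C v W hP hT hK ⟨y, hy0, hyne⟩ hF hnull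
    · push Not at hnull
      obtain ⟨y', hy'0, hy'hot, hy'curl⟩ := hnull
      exact hC2a C v W hP hT hK ⟨y, hy0, hyne⟩ hF ⟨y', hy'0, hy'hot, hy'curl⟩

/-! ## The two shared research stubs of the column (verbatim) -/

/-- **SHARED STUB S0 ((TH) column) — VERBATIM `stub_localTHEmptyHypNUGRS`** (twist_split = hot_loops v4.3 = loop_island = hot_split). -/
theorem stub_localTHEmptyHypNUGRS :
    ∀ (u : ℝ → EuclideanSpace ℝ (Fin 3) → EuclideanSpace ℝ (Fin 3)) (μ A : ℝ → ℝ → ℝ)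
      (U : Set (ℝ × EuclideanSpace ℝ (Fin 3))) (p₀ : ℝ × EuclideanSpace ℝ (Fin 3)),
      IsOpen U → p₀ ∈ U →
      AnalyticOnNhd ℝ (Function.uncurry u) U →
      (∀ p ∈ U, AnalyticAt ℝ (Function.uncurry μ) (p.1, p.2 2)) →
      (∀ p ∈ U, AnalyticAt ℝ (Function.uncurry A) (p.1, p.2 2)) →
      (∀ p ∈ U, fderiv ℝ (u p.1) p.2 (EuclideanSpace.single 0 1) 1 = fderiv ℝ (u p.1) p.2 (EuclideanSpace.single 1 1) 0) →
      (∀ p ∈ U, fderiv ℝ (u p.1) p.2 (EuclideanSpace.single 0 1) 0 + fderiv ℝ (u p.1) p.2 (EuclideanSpace.single 1 1) 1 +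
        fderiv ℝ (u p.1) p.2 (EuclideanSpace.single 2 1) 2 = 0) →
      (∀ p ∈ U, ∀ b : Fin 3, b ≠ 2 →
        fderiv ℝ (u p.1) p.2 (EuclideanSpace.single 2 1) b =
          μ p.1 (p.2 2) * fderiv ℝ (u p.1) p.2 (EuclideanSpace.single b 1) 2) →
      (∀ p ∈ U,
        (1 - μ p.1 (p.2 2)) *
            (deriv (fun s => u s p.2 2) p.1 + fderiv ℝ (fun y => u p.1 y 2) p.2 (u p.1 p.2)
              - Δ (fun y => u p.1 y 2) p.2) =
          A p.1 (p.2 2) + (deriv (fun s => μ s (p.2 2)) p.1 - deriv (deriv (μ p.1)) (p.2 2)) * u p.1 p.2 2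
            + deriv (μ p.1) (p.2 2) / 2 * u p.1 p.2 2 ^ 2
            - 2 * deriv (μ p.1) (p.2 2) * fderiv ℝ (u p.1) p.2 (EuclideanSpace.single 2 1) 2) →
      fderiv ℝ (fun y => fderiv ℝ (u p₀.1) y (EuclideanSpace.single 2 1) 2) p₀.2 (EuclideanSpace.single 0 1) *
            fderiv ℝ (u p₀.1) p₀.2 (EuclideanSpace.single 1 1) 2 -
          fderiv ℝ (fun y => fderiv ℝ (u p₀.1) y (EuclideanSpace.single 2 1) 2) p₀.2 (EuclideanSpace.single 1 1) *
            fderiv ℝ (u p₀.1) p₀.2 (EuclideanSpace.single 0 1) 2 ≠ 0 →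
      μ p₀.1 (p₀.2 2) ≠ 0 → μ p₀.1 (p₀.2 2) ≠ 1 → deriv (μ p₀.1) (p₀.2 2) ≠ 0 →
      μ p₀.1 (p₀.2 2) < 0 →
      (fderiv ℝ (u p₀.1) p₀.2 (EuclideanSpace.single 0 1) 0 ≠ fderiv ℝ (u p₀.1) p₀.2 (EuclideanSpace.single 1 1) 1 ∨
        fderiv ℝ (u p₀.1) p₀.2 (EuclideanSpace.single 1 1) 0 ≠ 0) →
      u p₀.1 p₀.2 = 0 → 
      fderiv ℝ (u p₀.1) p₀.2 (EuclideanSpace.single 0 1) 2 = 0 →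
      fderiv ℝ (u p₀.1) p₀.2 (EuclideanSpace.single 1 1) 2 = 1 → False := by
  sorry

/-- **THE WALL ⟨27893⟩ BY NAME (`stub_wall`)** — item `LoopPeriodRatchet.FrequencyGrowthExponent` (rank 2, OPEN; ⟺ NoIslands by `Lines/loop_island.lean`,
⟺ NoLoops by `Lines/noloops_wall.lean`).  Feeds the landed reduction only. -/
theorem stub_wall : FrequencyGrowthExponent := by
  sorry

/-! ## Compositions to the crux items BY NAME -/

/-- **HL3′ (the statement of `stub_peaklessEmpty`, hot_loops v4.3, VERBATIM) on this line** ⇐ Z-heat ∧ Z-oseen ∧ F ∧ A1 ∧ C2a ∧ C2b. -/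
theorem zeroMode_peaklessEmpty :
    ∀ (C : ℝ) (v : ℝ → EuclideanSpace ℝ (Fin 3) → EuclideanSpace ℝ (Fin 3)),
      Literature.Analysis.FluidPDE.HasTypeITimeDecay C v →
      ContinuousOn (Function.uncurry v) (Set.Iio (0 : ℝ) ×ˢ Set.univ) →
      (∀ s t : ℝ, s < t → t < 0 → ∀ x, v t x =
        Literature.Analysis.UnboundedOperators.heatExtension (v s) (t - s) x -
          Literature.Analysis.FluidPDE.oseenDuhamel 1 s v v t x) →
      (∀ t < 0, Literature.Analysis.FluidPDE.VectorCalculus.IsDivFree (v t)) →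
      (∀ s < 0, ∀ y, ⟪Literature.Analysis.FluidPDE.curl (v s) y, EuclideanSpace.single 2 1⟫_ℝ = 0) →
      v (-1) 0 2 ≠ 0 → (∀ t < 0, ∀ x, Real.sqrt (-t) * |v t x 2| ≤ |v (-1) 0 2|) →
      (∀ h : EuclideanSpace ℝ (Fin 3), fderiv ℝ (v (-1)) 0 h 2 = 0) →
      (deriv (fun s => v s 0 2) (-1) = v (-1) 0 2 / 2 ∧ v (-1) 0 2 * (Δ (fun y => v (-1) y 2)) 0 ≤ 0) →
      ∀ W : Set (ℝ × EuclideanSpace ℝ (Fin 3)), IsOpen W → W ⊆ Set.Iio (0 : ℝ) ×ˢ Set.univ →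
        (∀ z ∈ W, (Literature.Analysis.FluidPDE.curl (v z.1) z.2 ≠ 0 ∧
            (fderiv ℝ (v z.1) z.2 (EuclideanSpace.single 0 1) 2 ≠ 0 ∨ fderiv ℝ (v z.1) z.2 (EuclideanSpace.single 1 1) 2 ≠ 0) ∧
            (fderiv ℝ (v z.1) z.2 (EuclideanSpace.single 2 1) 0 ≠ 0 ∨ fderiv ℝ (v z.1) z.2 (EuclideanSpace.single 2 1) 1 ≠ 0)) ∧
          (fderiv ℝ (fun x => fderiv ℝ (v z.1) x (EuclideanSpace.single 2 1) 2) z.2 (EuclideanSpace.single 0 1) *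
                fderiv ℝ (v z.1) z.2 (EuclideanSpace.single 1 1) 2 -
              fderiv ℝ (fun x => fderiv ℝ (v z.1) x (EuclideanSpace.single 2 1) 2) z.2 (EuclideanSpace.single 1 1) *
                fderiv ℝ (v z.1) z.2 (EuclideanSpace.single 0 1) 2 ≠ 0)) →
        (∀ m : ℝ → ℝ → ℝ, ∀ W₁ : Set (ℝ × EuclideanSpace ℝ (Fin 3)), W₁ ⊆ W → IsOpen W₁ → W₁.Nonempty →
            ∃ z ∈ W₁, ∃ b : Fin 3, b ≠ 2 ∧
              fderiv ℝ (v z.1) z.2 (EuclideanSpace.single 2 1) b ≠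
                m z.1 (z.2 2) * fderiv ℝ (v z.1) z.2 (EuclideanSpace.single b 1) 2) →
        (∀ r : ℝ, 0 < r → (Metric.ball ((-1 : ℝ), (0 : EuclideanSpace ℝ (Fin 3))) r ∩ W).Nonempty) →
        (∀ (s z₀ σ M : ℝ) (K O : Set (EuclideanSpace ℝ (Fin 3))), s < 0 →
          ((σ = 1 ∨ σ = -1) ∧ IsCompact K ∧ K.Nonempty ∧ (∀ y ∈ K, y 2 = z₀ ∧ σ * v s y 2 = M) ∧
            IsOpen O ∧ K ⊆ O ∧ (∀ y ∈ O, y 2 = z₀ → σ * v s y 2 ≤ M) ∧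
            (∀ y ∈ O, y 2 = z₀ → σ * v s y 2 = M → y ∈ K)) → False) →
        False :=
  peaklessEmpty_of_ridgeCells stub_hotPlaneConst stub_cellC2a stub_cellC2b

/-- **The crux `PoloidalWindowRigidity` (K2, stmt-NavierStokesRegularity-19708) BY NAME ⇐ S0 ∧ ⟨27893⟩ ∧ Z ∧ F ∧ A1 ∧ C2a ∧ C2b**: tree
`…HotLoopsReduction.poloidalWindowRigidity_of_NUGRS_of_growth_of_peakless`.  CONDITIONAL; no summit is proved. -/
theorem PoloidalWindowRigidity_of_zeroMode :
    Summit.NavierStokesRegularity.NavierStokesRegularity.Theses.PoloidalWindowDoor.PoloidalWindowRigidity :=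
  PoloidalWindowDoorPoloidalWindowRigidityHotLoopsReduction.poloidalWindowRigidity_of_NUGRS_of_growth_of_peakless
    stub_localTHEmptyHypNUGRS stub_wall zeroMode_peaklessEmpty

/-- **The item `LrcModEntire` (stmt-NavierStokesRegularity-20428) BY NAME ⇐ S0 ∧ ⟨27893⟩ ∧ Z ∧ F ∧ A1 ∧ C2a ∧ C2b.** CONDITIONAL. -/
theorem LrcModEntire_of_zeroMode :
    Summit.NavierStokesRegularity.NavierStokesRegularity.Theses.PoloidalWindowDoor.LrcModEntire :=
  PoloidalWindowDoorPoloidalWindowRigidityHotLoopsReduction.lrcModEntire_of_NUGRS_of_growth_of_peakless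
    stub_localTHEmptyHypNUGRS stub_wall zeroMode_peaklessEmpty

end Summit.NavierStokesRegularity.NavierStokesRegularity.Cruxes.PoloidalWindowRigidity.ZeroMode
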